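import Summits.ValiantsHypothesis.ValiantsHypothesis.Theorems.LacunarySymmetroidMatrixDescartesVLawCoreSameSide
import Summits.ValiantsHypothesis.ValiantsHypothesis.Theorems.LacunarySymmetroidMatrixDescartesFanLaw
import Summits.ValiantsHypothesis.ValiantsHypothesis.Theorems.LacunarySymmetroidMatrixDescartesOneAlternation
import Summits.ValiantsHypothesis.ValiantsHypothesis.Theorems.LacunarySymmetroidMatrixDescartesCensusFatSectors

/-!
# `MatrixDescartes` (stmt-ValiantsHypothesis-18050), line `Lift` — the WIDE FAN LAW (same-side letters within a factor two)

HONEST FRAMING.  Cell `pub-symmetroid`, seat `val-sym-mdr-p2` (gen 2); helper `--supports` the crux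
`Theses.LacunarySymmetroid.MatrixDescartes`, NO closure claim.  Extends `…FanLaw.lean` (whose `fanLaw_lower/upper` is
the case of no same-side letters); the desk's siege target after `stub_vLaw` («the first two-letters-one-side
configuration not covered by the fan law», R1392) is addressed here for the configurations below.  Nothing here bears on
`stub_twoSided` in general, the crux in its window, `DoorA26`/`DoorA34`, or `VP ≠ VNP`.

**WIDE FAN LAW** (`fanLawTwo_lower`, mirror `fanLawTwo_upper`).  `F(X) = X^e J + ∑ k, X^{d k} P k`, `J` real symmetric,
all `P k ⪰ 0`.  Suppose there is a FACTORING letter `k₀` with gap `a = |d k₀ − e| > 0` such that every other letter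
`k` is EITHER on the opposite side of the pivot with a strictly smaller gap (`|d k − e| < a`) OR on the same side as
`k₀` with a gap strictly between `a` and `2a`.  Then `det F` has at most `2 · card ι` distinct positive zeros — for
every number of letters and every size.  Example newly covered: lower letter at gap 1, upper letters at gaps 2 and 3
(factor through the gap-2 letter: `1 < 2`, `2 < 3 < 4`); the census's `3n` witness `{2}|{1,3}` is NOT covered (no
letter factors), as it must not be.  In terms of signed gap ratios `γ = β_k/β_{k₀}` the admissible range is
`γ ∈ (−1, 0) ∪ (1, 2)` — exactly the open part of the set where the second-divided-difference kernel of `w^γ` is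
positive semidefinite; the closed boundary (`γ ∈ {−1, 1, 2}`: point-mass kernels) is where this method's strictness
argument stops.
PROOF.  As in `…FanLaw.lean`: ascending/descending classification of kernel vectors by the Rayleigh slope, the chain
lemma `VLawChain.linearIndependent_of_chain` (tree), and the two-family STAR core lemma
`VLawCoreSameSide.core_pos₂`.  [folklore] given the companion files.
-/

-- layout Summits/ValiantsHypothesis/ValiantsHypothesis forces the duplicated namespace component
set_option linter.dupNamespace false

namespace Summit.ValiantsHypothesis.ValiantsHypothesis.Theorems.LacunarySymmetroidMatrixDescartes

open Polynomial Matrix Finset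
open scoped BigOperators

namespace FanLawTwo

variable {ι : Type} [Fintype ι] [DecidableEq ι] {κ : Type} [Fintype κ] [DecidableEq κ]

omit [Fintype ι] [DecidableEq ι] in
/-- H-form of a wide lower fan at `t ≠ 0`: factoring letter `k₀` below the pivot (gap `a = e − d k₀`), the other
letters split into those above the pivot and those below it. [folklore] -/
theorem pencil_eq_smul_hform₂ (e : ℕ) (d : κ → ℕ) (J : Matrix ι ι ℝ) (P : κ → Matrix ι ι ℝ) (k₀ : κ)
    (hlow : d k₀ ≤ e) (hup : ∀ k, k ≠ k₀ → e < d k → e ≤ d k) (hdn : ∀ k, k ≠ k₀ → ¬ e < d k → d k ≤ e)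
    {t : ℝ} (ht : t ≠ 0) :
    t ^ e • J + ∑ k, t ^ d k • P k
      = t ^ e • (J + (t ^ (e - d k₀))⁻¹ • P k₀
          + ∑ l : {k // k ≠ k₀ ∧ e < d k}, t ^ (d l.1 - e) • P l.1
          + ∑ m : {k // k ≠ k₀ ∧ ¬ e < d k}, (t ^ (e - d m.1))⁻¹ • P m.1) := by
  classical
  rw [smul_add, smul_add, smul_add, Finset.smul_sum, Finset.smul_sum, smul_smul,
    ← Finset.add_sum_erase _ _ (Finset.mem_univ k₀),
    ← Finset.sum_filter_add_sum_filter_not (Finset.univ.erase k₀) (fun k => e < d k),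
    Finset.sum_subtype ((Finset.univ.erase k₀).filter (fun k => e < d k)) (p := fun k => k ≠ k₀ ∧ e < d k)
      (fun k => by simp [Finset.mem_erase, Finset.mem_filter]),
    Finset.sum_subtype ((Finset.univ.erase k₀).filter (fun k => ¬ e < d k)) (p := fun k => k ≠ k₀ ∧ ¬ e < d k)
      (fun k => by simp [Finset.mem_erase, Finset.mem_filter]),
    add_assoc, add_assoc]
  congr 2
  · rw [← pow_sub₀ t ht (Nat.sub_le e (d k₀)), show e - (e - d k₀) = d k₀ by omega]
  · congr 1
    · refine Finset.sum_congr rfl fun l _ => ?_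
      rw [smul_smul, ← pow_add, show e + (d l.1 - e) = d l.1 by have := hup l.1 l.2.1 l.2.2; omega]
    · refine Finset.sum_congr rfl fun m _ => ?_
      rw [smul_smul, ← pow_sub₀ t ht (Nat.sub_le e (d m.1)),
        show e - (e - d m.1) = d m.1 by have := hdn m.1 m.2.1 m.2.2; omega]

/-- **Wide lower fan law.**  Factoring letter `k₀` below the pivot with gap `a = e − d k₀`; every other letter is
either above the pivot with gap `< a`, or below the pivot with gap in `(a, 2a)` ⇒ `Z₊ ≤ 2 · card ι`. [folklore] -/
theorem fanLawTwo_lower (e : ℕ) (d : κ → ℕ) (J : Matrix ι ι ℝ) (P : κ → Matrix ι ι ℝ) (k₀ : κ)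
    (hJ : J.IsSymm) (hP : ∀ k, (P k).PosSemidef) (hlow : d k₀ < e)
    (hfan : ∀ k, k ≠ k₀ → (e < d k ∧ d k - e < e - d k₀)
      ∨ (d k < e ∧ e - d k₀ < e - d k ∧ e - d k < 2 * (e - d k₀))) :
    ((Matrix.det (((Polynomial.X : Polynomial ℝ) ^ e) • J.map Polynomial.C
        + ∑ k, ((Polynomial.X : Polynomial ℝ) ^ d k) • (P k).map Polynomial.C)).roots.toFinset.filter
          (fun t => 0 < t)).card ≤ 2 * Fintype.card ι := by
  classical
  set p := Matrix.det (((Polynomial.X : Polynomial ℝ) ^ e) • J.map Polynomial.C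
        + ∑ k, ((Polynomial.X : Polynomial ℝ) ^ d k) • (P k).map Polynomial.C) with hp
  by_cases hdet : p = 0
  · simp [hdet]
  have hup : ∀ k, k ≠ k₀ → e < d k → e ≤ d k := fun k _ h => h.le
  have hdn : ∀ k, k ≠ k₀ → ¬ e < d k → d k ≤ e := fun k _ h => Nat.le_of_not_lt h
  have hopp : ∀ l : {k // k ≠ k₀ ∧ e < d k}, d l.1 - e < e - d k₀ := fun l => by
    rcases hfan l.1 l.2.1 with h | h
    · exact h.2
    · exact absurd h.1 (by have := l.2.2; omega)
  have hsame : ∀ m : {k // k ≠ k₀ ∧ ¬ e < d k},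
      d m.1 < e ∧ e - d k₀ < e - d m.1 ∧ e - d m.1 < 2 * (e - d k₀) := fun m => by
    rcases hfan m.1 m.2.1 with h | h
    · exact absurd h.1 m.2.2
    · exact h
  -- the H-form data
  set a : ℕ := e - d k₀ with ha_def
  have ha : 0 < a := by omega
  set b : {k // k ≠ k₀ ∧ e < d k} → ℕ := fun l => d l.1 - e with hb_def
  set n : {k // k ≠ k₀ ∧ e < d k} → ℕ := fun l => a - 1 - b l with hn_def
  have hb : ∀ l, 0 < b l := fun l => by have := l.2.2; simp only [hb_def]; omega
  have hnb : ∀ l, n l + b l + 1 = a := fun l => by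
    have := hopp l; simp only [hn_def, hb_def, ha_def] at this ⊢; omega
  set c : {k // k ≠ k₀ ∧ ¬ e < d k} → ℕ := fun m => e - d m.1 with hc_def
  set b' : {k // k ≠ k₀ ∧ ¬ e < d k} → ℕ := fun m => 2 * a - c m with hb'_def
  set n' : {k // k ≠ k₀ ∧ ¬ e < d k} → ℕ := fun m => a - 1 - b' m with hn'_def
  have hb' : ∀ m, 0 < b' m := fun m => by
    have := hsame m; simp only [hb'_def, hc_def, ha_def] at this ⊢; omega
  have hcb : ∀ m, c m + b' m = 2 * a := fun m => by
    have := hsame m; simp only [hb'_def, hc_def, ha_def] at this ⊢; omega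
  have hnb' : ∀ m, n' m + b' m + 1 = a := fun m => by
    have := hsame m; simp only [hn'_def, hb'_def, hc_def, ha_def] at this ⊢; omega
  set Q : {k // k ≠ k₀ ∧ e < d k} → Matrix ι ι ℝ := fun l => P l.1 with hQ_def
  set R : {k // k ≠ k₀ ∧ ¬ e < d k} → Matrix ι ι ℝ := fun m => P m.1 with hR_def
  have hQ : ∀ l, (Q l).PosSemidef := fun l => hP l.1
  have hR : ∀ m, (R m).PosSemidef := fun m => hP m.1
  set G : ℝ → Matrix ι ι ℝ := fun t => t ^ e • J + ∑ k, t ^ d k • P k with hG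
  set H : ℝ → Matrix ι ι ℝ := fun t =>
    J + (t ^ a)⁻¹ • P k₀ + ∑ l, t ^ (b l) • Q l + ∑ m, (t ^ (c m))⁻¹ • R m with hH
  have hGH : ∀ t : ℝ, t ≠ 0 → G t = t ^ e • H t := fun t ht =>
    pencil_eq_smul_hform₂ e d J P k₀ hlow.le hup hdn ht
  set Rt := p.roots.toFinset.filter (fun t => 0 < t) with hRt
  have hroot : ∀ t ∈ Rt, 0 < t ∧ Matrix.det (G t) = 0 := by
    intro t ht
    have h1 := (Finset.mem_filter.1 ht)
    rw [Multiset.mem_toFinset, Polynomial.mem_roots hdet, Polynomial.IsRoot.def, hp,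
      StubReverse.eval_det_pencil] at h1
    exact ⟨h1.2, h1.1⟩
  have hkerH : ∀ t : ℝ, 0 < t → ∀ v : ι → ℝ, G t *ᵥ v = 0 → H t *ᵥ v = 0 := by
    intro t ht v hv
    rw [hGH t ht.ne', smul_mulVec, smul_eq_zero] at hv
    exact hv.resolve_left (pow_ne_zero e ht.ne')
  -- nondegeneracy from `p ≠ 0`
  have hnd : ∀ v : ι → ℝ, v ≠ 0 →
      ¬ (J *ᵥ v = 0 ∧ P k₀ *ᵥ v = 0 ∧ (∀ l, Q l *ᵥ v = 0) ∧ ∀ m, R m *ᵥ v = 0) := by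
    rintro v hv ⟨hJv, hPv, hQv, hRv⟩
    apply hdet
    apply Polynomial.eq_zero_of_infinite_isRoot
    refine Set.infinite_of_forall_exists_gt fun t₀ => ⟨max t₀ 0 + 1, ?_, by
      have := le_max_left t₀ 0; linarith⟩
    have ht : (0 : ℝ) < max t₀ 0 + 1 := by have := le_max_right t₀ 0; linarith
    rw [Set.mem_setOf_eq, Polynomial.IsRoot.def, hp, StubReverse.eval_det_pencil]
    have hGv : G (max t₀ 0 + 1) *ᵥ v = 0 := by
      rw [hGH _ ht.ne', smul_mulVec, add_mulVec, add_mulVec, add_mulVec, smul_mulVec, hJv, hPv, smul_zero,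
        add_zero, Matrix.sum_mulVec, Finset.sum_eq_zero (fun l _ => by rw [smul_mulVec, hQv l, smul_zero]),
        add_zero, Matrix.sum_mulVec, Finset.sum_eq_zero (fun m _ => by rw [smul_mulVec, hRv m, smul_zero]),
        add_zero, smul_zero]
    exact (Matrix.exists_mulVec_eq_zero_iff.1 ⟨v, hv, hGv⟩)
  -- slope of the Rayleigh quotient at a node
  set σ : ℝ → (ι → ℝ) → ℝ := fun t v =>
    -((a : ℝ) * (t ^ a)⁻¹ * (v ⬝ᵥ (P k₀ *ᵥ v))) + ∑ l, (b l : ℝ) * t ^ (b l) * (v ⬝ᵥ (Q l *ᵥ v))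
      - ∑ m, (c m : ℝ) * (t ^ (c m))⁻¹ * (v ⬝ᵥ (R m *ᵥ v)) with hσ
  set TA : ℝ → Prop := fun t => ∃ v : ι → ℝ, v ≠ 0 ∧ G t *ᵥ v = 0 ∧ 0 ≤ σ t v with hTA
  set TD : ℝ → Prop := fun t => ∃ v : ι → ℝ, v ≠ 0 ∧ G t *ᵥ v = 0 ∧ σ t v ≤ 0 with hTD
  have hcover : Rt ⊆ Rt.filter TA ∪ Rt.filter TD := by
    intro t ht
    obtain ⟨v, hv, hGv⟩ := Matrix.exists_mulVec_eq_zero_iff.2 (hroot t ht).2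
    rcases le_total 0 (σ t v) with h | h
    · exact Finset.mem_union.2 (Or.inl (Finset.mem_filter.2 ⟨ht, v, hv, hGv, h⟩))
    · exact Finset.mem_union.2 (Or.inr (Finset.mem_filter.2 ⟨ht, v, hv, hGv, h⟩))
  -- the STAR core lemma with same-side letters, specialised
  have hcore : ∀ (mm : ℕ) (u : Fin mm → ℝ) (w : Fin mm → ι → ℝ), (∀ j, 0 < u j) → Function.Injective u →
      (∀ j, w j ≠ 0) → (∀ j, G (u j) *ᵥ w j = 0) → ∀ s : ℝ, 0 < s → (∀ j, s ≠ u j) →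
      (∀ j, 0 ≤ (s - u j) * σ (u j) (w j)) → ∀ cc : Fin mm → ℝ, cc ≠ 0 →
      0 < (∑ j, cc j • w j) ⬝ᵥ (G s *ᵥ ∑ j, cc j • w j) := by
    intro mm u w hu huinj hw0 hker s hs hsu hstar cc hcc
    have h := VLawCoreSameSide.core_pos₂ a ha b n hnb hb c n' b' hnb' hb' hcb J (P k₀) Q R hJ (hP k₀) hQ hR
      u hu huinj w (fun j => hkerH _ (hu j) _ (hker j)) s hs hsu hstar (fun j => hnd _ (hw0 j)) cc hcc
    rw [hGH s hs.ne', smul_mulVec, dotProduct_smul, smul_eq_mul]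
    exact mul_pos (pow_pos hs e) h
  -- ascending zeros: at most `card ι`
  have hcardA : (Rt.filter TA).card ≤ Fintype.card ι := by
    set RA := Rt.filter TA with hRA
    let τ : Fin RA.card ↪o ℝ := RA.orderEmbOfFin rfl
    have hτmem : ∀ j, τ j ∈ RA := fun j => RA.orderEmbOfFin_mem rfl j
    have hτA : ∀ j, TA (τ j) := fun j => (Finset.mem_filter.1 (hτmem j)).2
    have hτpos : ∀ j, 0 < τ j := fun j => (hroot _ (Finset.mem_filter.1 (hτmem j)).1).1
    choose v hv0 hker htyp using hτA
    have hli : LinearIndependent ℝ v :=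
      VLawChain.linearIndependent_of_chain G τ v hv0 hker fun j hj _ cc hcc =>
        hcore j (fun i => τ (Fin.castLE hj.le i)) (fun i => v (Fin.castLE hj.le i))
          (fun i => hτpos _)
          (fun i i' h => Fin.castLE_injective hj.le (τ.injective h))
          (fun i => hv0 _) (fun i => hker _) (τ ⟨j, hj⟩) (hτpos _)
          (fun i => (τ.strictMono (show Fin.castLE hj.le i < ⟨j, hj⟩ from i.2)).ne')
          (fun i => mul_nonneg (sub_nonneg.2
            (τ.strictMono (show Fin.castLE hj.le i < ⟨j, hj⟩ from i.2)).le) (htyp _)) cc hcc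
    have h := hli.fintype_card_le_finrank
    rwa [Fintype.card_fin, Module.finrank_fintype_fun_eq_card] at h
  -- descending zeros: at most `card ι`
  have hcardD : (Rt.filter TD).card ≤ Fintype.card ι := by
    set RD := Rt.filter TD with hRD
    let τ₀ : Fin RD.card ↪o ℝ := RD.orderEmbOfFin rfl
    set τ : Fin RD.card → ℝ := fun j => τ₀ (Fin.rev j) with hτ
    have hτanti : StrictAnti τ := fun i i' h => τ₀.strictMono (Fin.rev_lt_rev.2 h)
    have hτmem : ∀ j, τ j ∈ RD := fun j => RD.orderEmbOfFin_mem rfl (Fin.rev j)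
    have hτD : ∀ j, TD (τ j) := fun j => (Finset.mem_filter.1 (hτmem j)).2
    have hτpos : ∀ j, 0 < τ j := fun j => (hroot _ (Finset.mem_filter.1 (hτmem j)).1).1
    choose v hv0 hker htyp using hτD
    have hli : LinearIndependent ℝ v :=
      VLawChain.linearIndependent_of_chain G τ v hv0 hker fun j hj _ cc hcc =>
        hcore j (fun i => τ (Fin.castLE hj.le i)) (fun i => v (Fin.castLE hj.le i))
          (fun i => hτpos _)
          (fun i i' h => Fin.castLE_injective hj.le (hτanti.injective h))
          (fun i => hv0 _) (fun i => hker _) (τ ⟨j, hj⟩) (hτpos _)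
          (fun i => (hτanti (show Fin.castLE hj.le i < ⟨j, hj⟩ from i.2)).ne)
          (fun i => mul_nonneg_of_nonpos_of_nonpos (sub_nonpos.2
            (hτanti (show Fin.castLE hj.le i < ⟨j, hj⟩ from i.2)).le) (htyp _)) cc hcc
    have h := hli.fintype_card_le_finrank
    rwa [Fintype.card_fin, Module.finrank_fintype_fun_eq_card] at h
  calc Rt.card ≤ (Rt.filter TA ∪ Rt.filter TD).card := Finset.card_le_card hcover
    _ ≤ (Rt.filter TA).card + (Rt.filter TD).card := Finset.card_union_le _ _
    _ ≤ Fintype.card ι + Fintype.card ι := Nat.add_le_add hcardA hcardD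
    _ = 2 * Fintype.card ι := by ring

/-- **Wide upper fan law** (mirror, via `stub_reverse`): factoring letter `k₀` above the pivot with gap
`a = d k₀ − e`; every other letter either below the pivot with gap `< a` or above it with gap in `(a, 2a)`. [folklore] -/
theorem fanLawTwo_upper (e : ℕ) (d : κ → ℕ) (J : Matrix ι ι ℝ) (P : κ → Matrix ι ι ℝ) (k₀ : κ)
    (hJ : J.IsSymm) (hP : ∀ k, (P k).PosSemidef) (hup : e < d k₀)
    (hfan : ∀ k, k ≠ k₀ → (d k < e ∧ e - d k < d k₀ - e)
      ∨ (e < d k ∧ d k₀ - e < d k - e ∧ d k - e < 2 * (d k₀ - e))) :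
    ((Matrix.det (((Polynomial.X : Polynomial ℝ) ^ e) • J.map Polynomial.C
        + ∑ k, ((Polynomial.X : Polynomial ℝ) ^ d k) • (P k).map Polynomial.C)).roots.toFinset.filter
          (fun t => 0 < t)).card ≤ 2 * Fintype.card ι := by
  -- reflect at `N = 2 · d k₀` (an upper bound for every exponent)
  have hd : ∀ k, d k ≤ 2 * d k₀ := by
    intro k
    by_cases hk : k = k₀
    · rw [hk]; omega
    · rcases hfan k hk with h | h <;> omega
  rw [stub_reverse ι κ e (2 * d k₀) d J P (by omega) hd]
  refine fanLawTwo_lower (2 * d k₀ - e) (fun k => 2 * d k₀ - d k) J P k₀ hJ hP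
    (show 2 * d k₀ - d k₀ < 2 * d k₀ - e by omega) fun k hk => ?_
  rcases hfan k hk with h | h
  · left
    show 2 * d k₀ - e < 2 * d k₀ - d k ∧ 2 * d k₀ - d k - (2 * d k₀ - e) < 2 * d k₀ - e - (2 * d k₀ - d k₀)
    omega
  · right
    show 2 * d k₀ - d k < 2 * d k₀ - e ∧ 2 * d k₀ - e - (2 * d k₀ - d k₀) < 2 * d k₀ - e - (2 * d k₀ - d k)
      ∧ 2 * d k₀ - e - (2 * d k₀ - d k) < 2 * (2 * d k₀ - e - (2 * d k₀ - d k₀))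
    omega

end FanLawTwo

open FanLawTwo

/-- **Wide fan words, positive zeros** (crux currency).  `∑ₗ X^{dₗ} Sₗ` (`K` letters, `m × m`), pivot index `lp`
with `S lp` symmetric, all other letters `⪰ 0`, a factoring letter `lf ≠ lp` with gap `a = |d lf − d lp| > 0`, and
every other letter either on the opposite side of `d lp` with gap `< a` or on the same side as `lf` with gap in
`(a, 2a)` ⇒ at most `2m` distinct positive zeros, for every `K`. [folklore] -/
theorem fanWordTwo_posRoots_le (K m : ℕ) (d : Fin K → ℕ) (S : Fin K → Matrix (Fin m) (Fin m) ℝ) (lp lf : Fin K)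
    (hne : lf ≠ lp) (hS : (S lp).IsSymm) (hpsd : ∀ l, l ≠ lp → (S l).PosSemidef)
    (hfan : (d lf < d lp ∧ ∀ l, l ≠ lp → l ≠ lf → (d lp < d l ∧ d l - d lp < d lp - d lf)
        ∨ (d l < d lp ∧ d lp - d lf < d lp - d l ∧ d lp - d l < 2 * (d lp - d lf)))
      ∨ (d lp < d lf ∧ ∀ l, l ≠ lp → l ≠ lf → (d l < d lp ∧ d lp - d l < d lf - d lp)
        ∨ (d lp < d l ∧ d lf - d lp < d l - d lp ∧ d l - d lp < 2 * (d lf - d lp)))) :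
    ((Matrix.det (∑ l, ((Polynomial.X : Polynomial ℝ) ^ d l) • (S l).map Polynomial.C)).roots.toFinset.filter
        (fun t => 0 < t)).card ≤ 2 * m := by
  classical
  -- split the pencil at the pivot index (as in `FanLawMDR.pencil_split`)
  have hsplit : ∑ l, ((Polynomial.X : Polynomial ℝ) ^ d l) • (S l).map Polynomial.C
      = ((Polynomial.X : Polynomial ℝ) ^ d lp) • (S lp).map Polynomial.C
        + ∑ l : {l // l ≠ lp}, ((Polynomial.X : Polynomial ℝ) ^ d l.1) • (S l.1).map Polynomial.C := by
    rw [← Finset.add_sum_erase _ _ (Finset.mem_univ lp),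
      Finset.sum_subtype (Finset.univ.erase lp) (p := fun l => l ≠ lp) (fun l => by simp [Finset.mem_erase])]
  rw [hsplit]
  have hP : ∀ l : {l // l ≠ lp}, (S l.1).PosSemidef := fun l => hpsd l.1 l.2
  rcases hfan with ⟨hlow, h⟩ | ⟨hup, h⟩
  · have := fanLawTwo_lower (κ := {l // l ≠ lp}) (d lp) (fun l => d l.1) (S lp) (fun l => S l.1) ⟨lf, hne⟩ hS hP
      hlow fun l hl => h l.1 l.2 fun hll => hl (Subtype.ext hll)
    simpa using this
  · have := fanLawTwo_upper (κ := {l // l ≠ lp}) (d lp) (fun l => d l.1) (S lp) (fun l => S l.1) ⟨lf, hne⟩ hS hP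
      hup fun l hl => h l.1 l.2 fun hll => hl (Subtype.ext hll)
    simpa using this

/-- **Wide fan words, all real zeros**: with non-pivot exponents of one parity, `F(−X)` is again a wide fan word, so
`det F` has at most `4m + 1` distinct real zeros. [folklore] -/
theorem fanWordTwo_realRoots_le (K m : ℕ) (d : Fin K → ℕ) (S : Fin K → Matrix (Fin m) (Fin m) ℝ) (lp lf : Fin K)
    (hne : lf ≠ lp) (hS : (S lp).IsSymm) (hpsd : ∀ l, l ≠ lp → (S l).PosSemidef)
    (hfan : (d lf < d lp ∧ ∀ l, l ≠ lp → l ≠ lf → (d lp < d l ∧ d l - d lp < d lp - d lf)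
        ∨ (d l < d lp ∧ d lp - d lf < d lp - d l ∧ d lp - d l < 2 * (d lp - d lf)))
      ∨ (d lp < d lf ∧ ∀ l, l ≠ lp → l ≠ lf → (d l < d lp ∧ d lp - d l < d lf - d lp)
        ∨ (d lp < d l ∧ d lf - d lp < d l - d lp ∧ d l - d lp < 2 * (d lf - d lp))))
    (hpar : (∀ l, l ≠ lp → Even (d l)) ∨ (∀ l, l ≠ lp → Odd (d l))) :
    (Matrix.det (∑ l, ((Polynomial.X : Polynomial ℝ) ^ d l) • (S l).map Polynomial.C)).roots.toFinset.card
      ≤ 4 * m + 1 := by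
  have h1 := fanWordTwo_posRoots_le K m d S lp lf hne hS hpsd hfan
  have h3 := stub_negRoots K m d S
  have h2 : ((Matrix.det (∑ l, ((Polynomial.X : Polynomial ℝ) ^ d l) •
      (((-1 : ℝ) ^ d l) • S l).map Polynomial.C)).roots.toFinset.filter (fun t => 0 < t)).card ≤ 2 * m := by
    rcases hpar with hev | hodd
    · refine fanWordTwo_posRoots_le K m d (fun l => ((-1 : ℝ) ^ d l) • S l) lp lf hne (hS.smul _)
        (fun l hl => ?_) hfan
      simp only [(hev l hl).neg_one_pow, one_smul]
      exact hpsd l hl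
    · rw [← roots_det_pencil_neg d (fun l => ((-1 : ℝ) ^ d l) • S l)]
      refine fanWordTwo_posRoots_le K m d (fun l => -(((-1 : ℝ) ^ d l) • S l)) lp lf hne (hS.smul _).neg
        (fun l hl => ?_) hfan
      simp only [(hodd l hl).neg_one_pow, neg_smul, one_smul, neg_neg]
      exact hpsd l hl
  omega

/-- **`MatrixDescartes` holds on the wide fan sector, at every fat format.**  For all `c, q` there is `K₀` such that
for all `K ≥ K₀`, all `m ≤ 2^((⌊log₂K⌋+c)^c)`, all exponents and letters forming a wide fan word (pivot `lp` symmetric,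
other letters `⪰ 0`, factoring letter `lf`, every other letter opposite with a smaller gap or same-side with gap in
`(a, 2a)`, non-pivot exponents of one parity): `Z^q ≤ 2^(K⌊log₂K⌋)`.  Nothing is claimed outside the sector. [folklore] -/
theorem fanWordTwo_mdr (c q : ℕ) : ∃ K₀ : ℕ, ∀ K m : ℕ, K₀ ≤ K → m ≤ 2 ^ ((Nat.log 2 K + c) ^ c) →
    ∀ (d : Fin K → ℕ) (S : Fin K → Matrix (Fin m) (Fin m) ℝ) (lp lf : Fin K), lf ≠ lp → (S lp).IsSymm →
      (∀ l, l ≠ lp → (S l).PosSemidef) →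
      ((d lf < d lp ∧ ∀ l, l ≠ lp → l ≠ lf → (d lp < d l ∧ d l - d lp < d lp - d lf)
          ∨ (d l < d lp ∧ d lp - d lf < d lp - d l ∧ d lp - d l < 2 * (d lp - d lf)))
        ∨ (d lp < d lf ∧ ∀ l, l ≠ lp → l ≠ lf → (d l < d lp ∧ d lp - d l < d lf - d lp)
          ∨ (d lp < d l ∧ d lf - d lp < d l - d lp ∧ d l - d lp < 2 * (d lf - d lp)))) →
      ((∀ l, l ≠ lp → Even (d l)) ∨ (∀ l, l ≠ lp → Odd (d l))) →
      (Matrix.det (∑ l, ((Polynomial.X : Polynomial ℝ) ^ d l) • (S l).map Polynomial.C)).roots.toFinset.card ^ q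
        ≤ 2 ^ (K * Nat.log 2 K) := by
  obtain ⟨K₀, hK₀⟩ := Census.fatFormat_absorb 2 c q
  refine ⟨K₀, fun K m hK hm d S lp lf hne hS hpsd hfan hpar => hK₀ K m _ hK hm ?_⟩
  have h := fanWordTwo_realRoots_le K m d S lp lf hne hS hpsd hfan hpar
  have : 4 * m + 1 ≤ 2 ^ 2 * (m + 1) * (K + 1) := by nlinarith
  exact h.trans this

/-- The wide fan laws in the census currency of the pivot column (`…CensusPivotDefs`): `pivotPosRoots e d J P ≤ 2m`
uniformly in `K` and in the pivot index, whenever a factoring letter exists. [folklore] -/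
theorem pivotPosRoots_wideFan_le (m K e : ℕ) (d : Fin K → ℕ) (J : Matrix (Fin m) (Fin m) ℝ)
    (P : Fin K → Matrix (Fin m) (Fin m) ℝ) (k₀ : Fin K) (hJ : J.IsSymm) (hP : ∀ k, (P k).PosSemidef)
    (hfan : (d k₀ < e ∧ ∀ k, k ≠ k₀ → (e < d k ∧ d k - e < e - d k₀)
        ∨ (d k < e ∧ e - d k₀ < e - d k ∧ e - d k < 2 * (e - d k₀)))
      ∨ (e < d k₀ ∧ ∀ k, k ≠ k₀ → (d k < e ∧ e - d k < d k₀ - e)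
        ∨ (e < d k ∧ d k₀ - e < d k - e ∧ d k - e < 2 * (d k₀ - e)))) :
    Pivot.pivotPosRoots e d J P ≤ 2 * m := by
  unfold Pivot.pivotPosRoots
  rcases hfan with ⟨hlow, h⟩ | ⟨hup, h⟩
  · simpa using fanLawTwo_lower e d J P k₀ hJ hP hlow h
  · simpa using fanLawTwo_upper e d J P k₀ hJ hP hup h

end Summit.ValiantsHypothesis.ValiantsHypothesis.Theorems.LacunarySymmetroidMatrixDescartes
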